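import Literature.NumberTheory.Sieve.QuadraticRootsPrimeModuliDFIBilinearFibre
import Literature.NumberTheory.Sieve.QuadraticRootsPrimeModuliDFI
import Mathlib.Algebra.Order.BigOperators.Ring.Finset
import HarnessLib

/-!
# Duke–Friedlander–Iwaniec 1995, §5: Cauchy's inequality for the bilinear form `B(M, N)`

Topic `Literature/NumberTheory/Sieve`.  Sixth file of the deduction of DFI's Propositions 1–2 from
Proposition 4 (W. Duke, J. B. Friedlander, H. Iwaniec, Ann. of Math. 141 (1995), §5
pp. 432–433): the passage from
`B(M, N) = ∑_m α_m ∑_{f(δ)≡0 (m)} ∑_{(n,m)=1} β_n ∑_{f(ν)≡0 (mn), ν≡δ (m)} e(νh/mn)` to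
"`|B(M, N)|² ≤ ‖αρ‖² ∑_m g(m) ∑_{f(δ)≡0 (m)} |∑_n ∑_ν|²`, where `g` is any function which majorizes
the characteristic function of the interval `[M, 2M]` … Squaring out the inner sums and changing
the order of summation we obtain `|B(M, N)|² ≤ ‖αρ‖² ∑_{n₁} ∑_{n₂} β_{n₁} β̄_{n₂} B_{n₁n₂}(M)`"
(pp. 432–433).  PROVED here, for an arbitrary `f ∈ ℤ[X]`, integer `h`, coefficients `α, β` and
any non-negative weight `G` that is `≥ 1` wherever `α ≠ 0`
(`DFI1995.bilinearForm`, `DFI1995.normAlphaRho` of `QuadraticRootsPrimeModuliDFI.lean`,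
`DFI1995.fibreSum`, `DFI1995.fibrePairSum` of `QuadraticRootsPrimeModuliDFIBilinearFibre.lean`):

* `DFI1995.bilinearForm_eq_sum_fibre` — the arrangement `B = ∑_m α_m ∑_δ X(m, δ)`,
  `X(m, δ) = ∑_{(n,m)=1} β_n fibreSum(m, n, δ)`;
* `DFI1995.norm_bilinearForm_sq_le_sigma₂` — Cauchy's inequality in `(m, δ)`:
  `|B|² ≤ (∑_m |α_m|² ρ(m)²) · ∑_{m : α_m ≠ 0} ∑_δ |X(m, δ)|²`
  (the paper's `‖αρ‖² = ∑ |α_m|² ρ(m)²` dominates the `∑ |α_m|² ρ(m)` that Cauchy produces);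
* `DFI1995.sum_norm_sq_fibre_eq` — squaring out: `∑_δ |X(m, δ)|² = ∑∑ β_{n₁} β̄_{n₂} fibrePairSum(m; n₁, n₂)`;
* `DFI1995.norm_bilinearForm_sq_le_master` — inserting the majorant and changing the order of
  summation:
  `|B|² ≤ ‖αρ‖² ∑_{n₁, n₂ ≤ 2N} |β_{n₁}| |β_{n₂}| · |∑_{m ∈ U, (m, n₁) = (m, n₂) = 1} G(m) fibrePairSum(m; n₁, n₂)|`,
  the inner sums being the paper's `B_{n₁n₂}(M)`.
  [cite: DukeFriedlanderIwaniec1995, §5 pp. 432–433]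

## References

* W. Duke, J. B. Friedlander, H. Iwaniec, Ann. of Math. (2) 141 (1995), 423–441, §5 pp. 432–433.
  [cite: DukeFriedlanderIwaniec1995, §5 pp. 432–433]
-/

noncomputable section

namespace Literature.NumberTheory.Sieve

open scoped BigOperators Polynomial ComplexConjugate
open Finset Polynomial

namespace DFI1995

variable (f : ℤ[X]) (h : ℤ) (α β : ℕ → ℂ) (M N : ℝ)

/-- The inner sums `X(m, δ) = ∑_{n ≤ 2N, (n, m) = 1} β_n fibreSum(m, n, δ)` of the arrangement of
`B(M, N)`. [cite: DukeFriedlanderIwaniec1995, §5 p. 432] -/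
def fibreX (m δ : ℕ) : ℂ :=
  ∑ n ∈ (Icc 1 ⌊2 * N⌋₊).filter (fun n : ℕ => Nat.Coprime m n), β n * fibreSum f h m n δ

/-- **The arrangement** `B(M, N) = ∑_m α_m ∑_{δ ∈ rootSet(m)} X(m, δ)`.
[cite: DukeFriedlanderIwaniec1995, §5 p. 432] -/
theorem bilinearForm_eq_sum_fibre :
    bilinearForm f h α β M N =
      ∑ m ∈ Icc 1 ⌊2 * M⌋₊, α m * ∑ δ ∈ rootSet f m, fibreX f h β N m δ := by
  unfold bilinearForm fibreX
  refine Finset.sum_congr rfl fun m hm => ?_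
  have hm0 : 0 < m := (Finset.mem_Icc.1 hm).1
  rw [Finset.sum_comm, Finset.mul_sum]
  refine Finset.sum_congr rfl fun n _ => ?_
  rw [polyRootWeylSum_mul_eq_sum_fibreSum f h hm0 n, Finset.mul_sum, Finset.mul_sum]
  refine Finset.sum_congr rfl fun δ _ => ?_
  ring

/-- **Cauchy's inequality in `(m, δ)`**:
`|B|² ≤ ‖αρ‖² · Σ₂`, `Σ₂ = ∑_{m ≤ 2M, α_m ≠ 0} ∑_{δ ∈ rootSet(m)} |X(m, δ)|²`
(`‖αρ‖² = ∑_{m ≤ 2M} |α_m|² ρ(m)² ≥ ∑ |α_m|² ρ(m)`). [cite: DukeFriedlanderIwaniec1995, §5 p. 432] -/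
theorem norm_bilinearForm_sq_le_sigma₂ :
    ‖bilinearForm f h α β M N‖ ^ 2 ≤ normAlphaRho f α M ^ 2 *
      ∑ m ∈ (Icc 1 ⌊2 * M⌋₊).filter (fun m => α m ≠ 0), ∑ δ ∈ rootSet f m, ‖fibreX f h β N m δ‖ ^ 2 := by
  classical
  set S' := (Icc 1 ⌊2 * M⌋₊).filter (fun m => α m ≠ 0) with hS'
  -- `B` as a sum over `S'`
  have hB : bilinearForm f h α β M N = ∑ m ∈ S', α m * ∑ δ ∈ rootSet f m, fibreX f h β N m δ := by
    rw [bilinearForm_eq_sum_fibre, hS', Finset.sum_filter]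
    refine Finset.sum_congr rfl fun m _ => ?_
    split_ifs with hα
    · rfl
    · rw [not_not.1 hα, zero_mul]
  -- the finset of pairs `(m, δ)`
  set P : Finset (Σ _ : ℕ, ℕ) := S'.sigma fun m => rootSet f m with hP
  set u : (Σ _ : ℕ, ℕ) → ℝ := fun p => ‖α p.1‖ with hu
  set v : (Σ _ : ℕ, ℕ) → ℝ := fun p => ‖fibreX f h β N p.1 p.2‖ with hv
  have h1 : ‖bilinearForm f h α β M N‖ ≤ ∑ p ∈ P, u p * v p := by
    rw [hB, hP, Finset.sum_sigma]
    refine (norm_sum_le _ _).trans (Finset.sum_le_sum fun m _ => ?_)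
    rw [norm_mul]
    calc ‖α m‖ * ‖∑ δ ∈ rootSet f m, fibreX f h β N m δ‖
        ≤ ‖α m‖ * ∑ δ ∈ rootSet f m, ‖fibreX f h β N m δ‖ :=
          mul_le_mul_of_nonneg_left (norm_sum_le _ _) (norm_nonneg _)
      _ = ∑ δ ∈ rootSet f m, u ⟨m, δ⟩ * v ⟨m, δ⟩ := by rw [Finset.mul_sum]
  have h2 : (∑ p ∈ P, u p * v p) ^ 2 ≤ (∑ p ∈ P, u p ^ 2) * ∑ p ∈ P, v p ^ 2 :=
    Finset.sum_mul_sq_le_sq_mul_sq P u v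
  have h3 : ∑ p ∈ P, u p ^ 2 ≤ normAlphaRho f α M ^ 2 := by
    rw [normAlphaRho, Real.sq_sqrt (Finset.sum_nonneg fun _ _ => by positivity), hP, Finset.sum_sigma]
    simp only [hu, Finset.sum_const, nsmul_eq_mul, card_rootSet]
    calc ∑ m ∈ S', (polyRootCountMod ![f] m : ℝ) * ‖α m‖ ^ 2
        ≤ ∑ m ∈ S', ‖α m‖ ^ 2 * (polyRootCountMod ![f] m : ℝ) ^ 2 := by
          refine Finset.sum_le_sum fun m _ => ?_
          have hρ : (polyRootCountMod ![f] m : ℝ) ≤ (polyRootCountMod ![f] m : ℝ) ^ 2 := by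
            rcases Nat.eq_zero_or_pos (polyRootCountMod ![f] m) with h0 | hpos
            · rw [h0]; norm_num
            · have : (1 : ℝ) ≤ polyRootCountMod ![f] m := by exact_mod_cast hpos
              nlinarith
          nlinarith [sq_nonneg ‖α m‖]
      _ ≤ ∑ m ∈ Icc 1 ⌊2 * M⌋₊, ‖α m‖ ^ 2 * (polyRootCountMod ![f] m : ℝ) ^ 2 :=
          Finset.sum_le_sum_of_subset_of_nonneg (Finset.filter_subset _ _) fun _ _ _ => by positivity
  have h4 : ∑ p ∈ P, v p ^ 2 = ∑ m ∈ S', ∑ δ ∈ rootSet f m, ‖fibreX f h β N m δ‖ ^ 2 := by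
    rw [hP, Finset.sum_sigma]
  have h0 : 0 ≤ ∑ p ∈ P, u p * v p := Finset.sum_nonneg fun p _ => by positivity
  calc ‖bilinearForm f h α β M N‖ ^ 2 ≤ (∑ p ∈ P, u p * v p) ^ 2 :=
        pow_le_pow_left₀ (norm_nonneg _) h1 2
    _ ≤ (∑ p ∈ P, u p ^ 2) * ∑ p ∈ P, v p ^ 2 := h2
    _ ≤ normAlphaRho f α M ^ 2 * ∑ p ∈ P, v p ^ 2 :=
        mul_le_mul_of_nonneg_right h3 (Finset.sum_nonneg fun _ _ => by positivity)
    _ = _ := by rw [h4]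

/-- **Squaring out**: `∑_{δ ∈ rootSet(m)} |X(m, δ)|² = ∑∑_{n₁, n₂} β_{n₁} β̄_{n₂} fibrePairSum(m; n₁, n₂)`
(as complex numbers). [cite: DukeFriedlanderIwaniec1995, §5 p. 433] -/
theorem sum_norm_sq_fibre_eq (m : ℕ) :
    ((∑ δ ∈ rootSet f m, ‖fibreX f h β N m δ‖ ^ 2 : ℝ) : ℂ) =
      ∑ n₁ ∈ (Icc 1 ⌊2 * N⌋₊).filter (fun n : ℕ => Nat.Coprime m n),
        ∑ n₂ ∈ (Icc 1 ⌊2 * N⌋₊).filter (fun n : ℕ => Nat.Coprime m n),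
          β n₁ * conj (β n₂) * fibrePairSum f h m n₁ n₂ := by
  push_cast
  have hsq : ∀ δ : ℕ, ((‖fibreX f h β N m δ‖ : ℂ)) ^ 2 =
      fibreX f h β N m δ * conj (fibreX f h β N m δ) := fun δ => (Complex.mul_conj' _).symm
  simp_rw [hsq]
  unfold fibreX fibrePairSum
  simp_rw [map_sum, map_mul, Finset.sum_mul_sum, Finset.mul_sum]
  rw [Finset.sum_comm]
  refine Finset.sum_congr rfl fun n₁ _ => ?_
  rw [Finset.sum_comm]
  refine Finset.sum_congr rfl fun n₂ _ => ?_
  refine Finset.sum_congr rfl fun δ _ => ?_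
  ring

/-- Double sums with a conjunction of conditions are double sums over the filtered sets.
[folklore] -/
theorem sum_sum_ite_and (s t : Finset ℕ) (p q : ℕ → Prop) [DecidablePred p] [DecidablePred q]
    (F : ℕ → ℕ → ℂ) :
    ∑ a ∈ s, ∑ b ∈ t, (if p a ∧ q b then F a b else 0) = ∑ a ∈ s.filter p, ∑ b ∈ t.filter q, F a b := by
  rw [Finset.sum_filter]
  refine Finset.sum_congr rfl fun a _ => ?_
  by_cases ha : p a
  · rw [if_pos ha, Finset.sum_filter]
    refine Finset.sum_congr rfl fun b _ => ?_
    simp only [ha, true_and]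
  · rw [if_neg ha]
    refine Finset.sum_eq_zero fun b _ => ?_
    simp only [ha, false_and, if_false]

/-- **The master inequality of §5** (majorant and change of the order of summation): for any finite
`U ⊆ ℕ` containing `{m ≤ 2M : α_m ≠ 0}` and any `G ≥ 0` on `U` with `G(m) ≥ 1` when `α_m ≠ 0`,
`|B(M, N)|² ≤ ‖αρ‖² ∑_{n₁, n₂ ≤ 2N} |β_{n₁}| |β_{n₂}| |∑_{m ∈ U, (m,n₁)=(m,n₂)=1} G(m) fibrePairSum(m; n₁, n₂)|`
("`|B(M,N)|² ≤ ‖αρ‖² ∑ g(m) ∑ |ΣΣ|²` … `≤ ‖αρ‖² ∑∑ β_{n₁} β̄_{n₂} B_{n₁n₂}(M)`", pp. 432–433).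
[cite: DukeFriedlanderIwaniec1995, §5 pp. 432–433] -/
theorem norm_bilinearForm_sq_le_master (U : Finset ℕ) (G : ℕ → ℝ)
    (hU : ∀ m ∈ Icc 1 ⌊2 * M⌋₊, α m ≠ 0 → m ∈ U) (hG0 : ∀ m ∈ U, 0 ≤ G m)
    (hG1 : ∀ m ∈ Icc 1 ⌊2 * M⌋₊, α m ≠ 0 → 1 ≤ G m) :
    ‖bilinearForm f h α β M N‖ ^ 2 ≤ normAlphaRho f α M ^ 2 *
      ∑ n₁ ∈ Icc 1 ⌊2 * N⌋₊, ∑ n₂ ∈ Icc 1 ⌊2 * N⌋₊, ‖β n₁‖ * ‖β n₂‖ *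
        ‖∑ m ∈ U.filter (fun m => Nat.Coprime m n₁ ∧ Nat.Coprime m n₂),
          (G m : ℂ) * fibrePairSum f h m n₁ n₂‖ := by
  classical
  refine (norm_bilinearForm_sq_le_sigma₂ f h α β M N).trans ?_
  refine mul_le_mul_of_nonneg_left ?_ (sq_nonneg _)
  set S' := (Icc 1 ⌊2 * M⌋₊).filter (fun m => α m ≠ 0) with hS'
  set Sn := Icc 1 ⌊2 * N⌋₊ with hSn
  -- insert the majorant
  have hmaj : ∑ m ∈ S', ∑ δ ∈ rootSet f m, ‖fibreX f h β N m δ‖ ^ 2 ≤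
      ∑ m ∈ U, G m * ∑ δ ∈ rootSet f m, ‖fibreX f h β N m δ‖ ^ 2 := by
    have hsub : S' ⊆ U := by
      intro m hm
      rw [hS', Finset.mem_filter] at hm
      exact hU m hm.1 hm.2
    calc ∑ m ∈ S', ∑ δ ∈ rootSet f m, ‖fibreX f h β N m δ‖ ^ 2
        ≤ ∑ m ∈ S', G m * ∑ δ ∈ rootSet f m, ‖fibreX f h β N m δ‖ ^ 2 := by
          refine Finset.sum_le_sum fun m hm => ?_
          rw [hS', Finset.mem_filter] at hm
          have := hG1 m hm.1 hm.2
          have h0 : 0 ≤ ∑ δ ∈ rootSet f m, ‖fibreX f h β N m δ‖ ^ 2 :=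
            Finset.sum_nonneg fun _ _ => by positivity
          nlinarith
      _ ≤ ∑ m ∈ U, G m * ∑ δ ∈ rootSet f m, ‖fibreX f h β N m δ‖ ^ 2 :=
          Finset.sum_le_sum_of_subset_of_nonneg hsub fun m hmU _ =>
            mul_nonneg (hG0 m hmU) (Finset.sum_nonneg fun _ _ => by positivity)
  refine hmaj.trans ?_
  -- pass to `ℂ`, square out, change the order of summation
  have hC : ((∑ m ∈ U, G m * ∑ δ ∈ rootSet f m, ‖fibreX f h β N m δ‖ ^ 2 : ℝ) : ℂ) =
      ∑ n₁ ∈ Sn, ∑ n₂ ∈ Sn, β n₁ * conj (β n₂) *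
        ∑ m ∈ U.filter (fun m => Nat.Coprime m n₁ ∧ Nat.Coprime m n₂),
          (G m : ℂ) * fibrePairSum f h m n₁ n₂ := by
    push_cast
    have hstep : ∀ m ∈ U, (G m : ℂ) * ∑ δ ∈ rootSet f m, ((‖fibreX f h β N m δ‖ : ℂ)) ^ 2 =
        ∑ n₁ ∈ Sn, ∑ n₂ ∈ Sn, if Nat.Coprime m n₁ ∧ Nat.Coprime m n₂ then
          β n₁ * conj (β n₂) * ((G m : ℂ) * fibrePairSum f h m n₁ n₂) else 0 := by
      intro m _
      have := sum_norm_sq_fibre_eq f h β N m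
      push_cast at this
      rw [this, sum_sum_ite_and Sn Sn (fun n => Nat.Coprime m n) (fun n => Nat.Coprime m n)
        (fun n₁ n₂ => β n₁ * conj (β n₂) * ((G m : ℂ) * fibrePairSum f h m n₁ n₂)), Finset.mul_sum]
      refine Finset.sum_congr rfl fun n₁ _ => ?_
      rw [Finset.mul_sum]
      refine Finset.sum_congr rfl fun n₂ _ => ?_
      ring
    rw [Finset.sum_congr rfl hstep, Finset.sum_comm]
    refine Finset.sum_congr rfl fun n₁ _ => ?_
    rw [Finset.sum_comm]
    refine Finset.sum_congr rfl fun n₂ _ => ?_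
    rw [Finset.mul_sum, Finset.sum_filter]
  -- take norms
  have hreal : ∑ m ∈ U, G m * ∑ δ ∈ rootSet f m, ‖fibreX f h β N m δ‖ ^ 2 =
      ‖((∑ m ∈ U, G m * ∑ δ ∈ rootSet f m, ‖fibreX f h β N m δ‖ ^ 2 : ℝ) : ℂ)‖ := by
    rw [Complex.norm_real, Real.norm_eq_abs, abs_of_nonneg]
    exact Finset.sum_nonneg fun m hm => mul_nonneg (hG0 m hm) (Finset.sum_nonneg fun _ _ => by positivity)
  rw [hreal, hC]
  refine (norm_sum_le _ _).trans (Finset.sum_le_sum fun n₁ _ => ?_)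
  refine (norm_sum_le _ _).trans (Finset.sum_le_sum fun n₂ _ => ?_)
  rw [norm_mul, norm_mul, Complex.norm_conj]

end DFI1995

end Literature.NumberTheory.Sieve
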